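import Summits.AtomisticToContinuum.Crystallization.Theorems.FreeSplittingCertificatesStrictSplittingRuleP1DemandSummable
import Summits.AtomisticToContinuum.Crystallization.Theorems.FreeSplittingCertificatesStrictSplittingRuleFarPencilGrowth

/-!
# `StrictSplittingRule` (stmt-AtomisticToContinuum-12560): the LEDGER'S BARE WEIGHTS — continuity, majorants, integrability of the radial-deficit and credit weights `c·χ²|x|⁻¹⁰xxᵀ`, `c·χ²|x|⁻⁸I`, and the bare-demand transfers instantiated for them (P1 interpolant object, part 45)

Route `FreeSplittingCertificates`, crux r3 `StrictSplittingRule` (H12⋆ = `stub_coreJointCoercive`), unit b2b-freesplit-B gen 32.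
VALUE = glue item G7 of the kernel assembly map (HOME FAR-LEMMA-SPEC §23 (b), term (T7)): the matched split's far share of a site's bare form is the hat-average of the
continuum densities of the certified pencil `N_F2` — radial deficit weight `W_rad(x) = c·χ(x)²·|x|⁻¹⁰·x xᵀ` (`c = κ(7D+C)/4`) and credit weight `W_cred(x) = c'·χ(x)²·|x|⁻⁸·I`
(`c' = κC/4`), `χ = fpChi S₁ S₂`.  The demand-side transfers of parts 29/31/41 take such a weight through three analytic facts, proved here once and for all:
* `continuous_fpChi_sq_mul` — `χ²·g` is continuous whenever `g` is continuous away from the origin (`χ` vanishes on the ball `|x|² ≤ S₁`); hence **`continuous_radWeight`**,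
  **`continuous_credWeight`**, `continuous_bareMajorant` (the common majorant `ω(x) = c·χ²|x|⁻⁸`);
* `p1Quad3_radWeight(_nonneg/_le)`, `p1Quad3_credWeight(_nonneg/_le)` — `q_{W_rad}(u) = cχ²s⁻⁵⟪x,u⟫²`, `q_{W_cred}(u) = c'χ²s⁻⁴|u|²`, both `≥ 0` and `≤ ω|u|²` (Cauchy–Schwarz);
* **`integrable_bareMajorant_growth`** — `ω(y)(1+‖y‖)²` is integrable on `ℝ³` (decay gauge `O(‖y‖⁻⁶)`, part 10's `integrable_of_isBigO_gauge`);
* **`summable_cellBare_p1DispSite`** — the lattice far-credit family `Σ_m p1CellBare` is summable for the far-ledger field (the `hsum` of the Jensen transfer, part 29);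
and instantiates the transfers for the far-ledger field `V = p1DispSite a h U b₀ A`: **`tsum_p1SiteBare_rad_le_p1DispSite`** (`Σ'_q` radial far shares `≤ ∫cχ²s⁻⁵⟪x,ṽ⟫² + Σ'_T(∫_Tω)ρ_T|G_T(U)−A|²`)
and **`integral_cred_le_tsum_p1SiteBare_p1DispSite`** (`∫c'χ²s⁻⁴|ṽ|² ≤ Σ'_q` credit far shares).  NOT a proof of H12⋆, NOT summit progress.  [folklore]
-/

noncomputable section

open Set Function Metric MeasureTheory Filter Topology Asymptotics
open scoped BigOperators NNReal ENNReal

namespace Summit.AtomisticToContinuum.Crystallization.Theorems.StrictSplittingRuleBirth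

open Literature.MathematicalPhysics.StatisticalMechanics
open Summit.AtomisticToContinuum.Crystallization.Theorems.PalmUnimodularRigidity.LayeredLawsSelectHcp

/-! ## Continuity of `χ²·g` for `g` continuous away from the origin -/

/-- `|x|²` is positive away from the origin. -/
theorem fpSq_pos_of_ne_zero {x : Fin 3 → ℝ} (hx : x ≠ 0) : 0 < fpSq x :=
  lt_of_le_of_ne (fpSq_nonneg x) fun h => hx ((fpSq_eq_zero_iff x).1 h.symm)

/-- `(|x|²)⁻ᵏ` is continuous away from the origin. -/
theorem continuousAt_fpSq_inv_pow {x : Fin 3 → ℝ} (hx : x ≠ 0) (k : ℕ) : ContinuousAt (fun y => (fpSq y)⁻¹ ^ k) x :=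
  ((continuous_fpSq.continuousAt).inv₀ (fpSq_pos_of_ne_zero hx).ne').pow k

/-- **`χ²·g` is continuous** for `χ = fpChi S₁ S₂` (`0 < S₁ < S₂`) and any `g` continuous away from the origin: near the origin `χ ≡ 0`. -/
theorem continuous_fpChi_sq_mul {S1 S2 : ℝ} (hS1 : 0 < S1) (hS12 : S1 < S2) {g : (Fin 3 → ℝ) → ℝ}
    (hg : ∀ x, x ≠ 0 → ContinuousAt g x) : Continuous fun x => fpChi S1 S2 x ^ 2 * g x := by
  refine continuous_iff_continuousAt.2 fun x => ?_
  by_cases hx : x = 0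
  · subst hx
    have hmem : {y : Fin 3 → ℝ | fpSq y < S1} ∈ 𝓝 (0 : Fin 3 → ℝ) :=
      (isOpen_lt continuous_fpSq continuous_const).mem_nhds (by simp [fpSq, hS1])
    have hev : (fun y => fpChi S1 S2 y ^ 2 * g y) =ᶠ[𝓝 0] fun _ => 0 := by
      filter_upwards [hmem] with y hy
      rw [fpChi_eq_zero hS12 hy.le]
      ring
    exact (continuousAt_const.congr hev.symm)
  · exact (((contDiff_two_fpChi S1 S2).continuous.continuousAt).pow 2).mul (hg x hx)

/-! ## The radial-deficit weight `c·χ²|x|⁻¹⁰xxᵀ`, the credit weight `c·χ²|x|⁻⁸I`, the common majorant `c·χ²|x|⁻⁸` -/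

/-- The radial weight is continuous (entrywise). -/
theorem continuous_radWeight {S1 S2 : ℝ} (hS1 : 0 < S1) (hS12 : S1 < S2) (c : ℝ) (k l : Fin 3) :
    Continuous fun x : Fin 3 → ℝ => c * fpChi S1 S2 x ^ 2 * (fpSq x)⁻¹ ^ 5 * (x k * x l) := by
  have h := continuous_fpChi_sq_mul hS1 hS12 (g := fun x => c * (fpSq x)⁻¹ ^ 5 * (x k * x l)) fun x hx =>
    (continuousAt_const.mul (continuousAt_fpSq_inv_pow hx 5)).mul
      (((continuous_apply k).continuousAt).mul ((continuous_apply l).continuousAt))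
  exact h.congr fun x => by ring

/-- The credit weight is continuous (entrywise). -/
theorem continuous_credWeight {S1 S2 : ℝ} (hS1 : 0 < S1) (hS12 : S1 < S2) (c : ℝ) (k l : Fin 3) :
    Continuous fun x : Fin 3 → ℝ => c * fpChi S1 S2 x ^ 2 * (fpSq x)⁻¹ ^ 4 * (if k = l then 1 else 0) := by
  have h := continuous_fpChi_sq_mul hS1 hS12 (g := fun x => c * (fpSq x)⁻¹ ^ 4 * (if k = l then 1 else 0)) fun x hx =>
    (continuousAt_const.mul (continuousAt_fpSq_inv_pow hx 4)).mul continuousAt_const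
  exact h.congr fun x => by ring

/-- The common majorant `ω = c·χ²|x|⁻⁸` is continuous. -/
theorem continuous_bareMajorant {S1 S2 : ℝ} (hS1 : 0 < S1) (hS12 : S1 < S2) (c : ℝ) :
    Continuous fun x : Fin 3 → ℝ => c * fpChi S1 S2 x ^ 2 * (fpSq x)⁻¹ ^ 4 := by
  have h := continuous_fpChi_sq_mul hS1 hS12 (g := fun x => c * (fpSq x)⁻¹ ^ 4) fun x hx =>
    continuousAt_const.mul (continuousAt_fpSq_inv_pow hx 4)
  exact h.congr fun x => by ring

/-- The radial weight's quadratic form: `q(u) = cχ²s⁻⁵⟪x,u⟫²`. -/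
theorem p1Quad3_radWeight (c S1 S2 : ℝ) (x u : Fin 3 → ℝ) :
    p1Quad3 (fun k l => c * fpChi S1 S2 x ^ 2 * (fpSq x)⁻¹ ^ 5 * (x k * x l)) u =
      c * fpChi S1 S2 x ^ 2 * (fpSq x)⁻¹ ^ 5 * fpDot x u ^ 2 := by
  rw [p1Quad3_eq, fpDot]
  ring

/-- The credit weight's quadratic form: `q(u) = cχ²s⁻⁴|u|²`. -/
theorem p1Quad3_credWeight (c S1 S2 : ℝ) (x u : Fin 3 → ℝ) :
    p1Quad3 (fun k l => c * fpChi S1 S2 x ^ 2 * (fpSq x)⁻¹ ^ 4 * (if k = l then 1 else 0)) u =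
      c * fpChi S1 S2 x ^ 2 * (fpSq x)⁻¹ ^ 4 * (u 0 ^ 2 + u 1 ^ 2 + u 2 ^ 2) := by
  rw [p1Quad3_eq]
  simp only [Fin.isValue, ↓reduceIte, Fin.zero_eq_one_iff, Fin.reduceEq, one_ne_zero]
  norm_num
  ring

/-- The radial form is nonnegative (`c ≥ 0`). -/
theorem p1Quad3_radWeight_nonneg {c : ℝ} (hc : 0 ≤ c) (S1 S2 : ℝ) (x u : Fin 3 → ℝ) :
    0 ≤ p1Quad3 (fun k l => c * fpChi S1 S2 x ^ 2 * (fpSq x)⁻¹ ^ 5 * (x k * x l)) u := by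
  rw [p1Quad3_radWeight]
  have := fpSq_nonneg x
  positivity

/-- The credit form is nonnegative (`c ≥ 0`). -/
theorem p1Quad3_credWeight_nonneg {c : ℝ} (hc : 0 ≤ c) (S1 S2 : ℝ) (x u : Fin 3 → ℝ) :
    0 ≤ p1Quad3 (fun k l => c * fpChi S1 S2 x ^ 2 * (fpSq x)⁻¹ ^ 4 * (if k = l then 1 else 0)) u := by
  rw [p1Quad3_credWeight]
  have := fpSq_nonneg x
  positivity

/-- The radial form is dominated by the majorant: `cχ²s⁻⁵⟪x,u⟫² ≤ (cχ²s⁻⁴)·|u|²` (Cauchy–Schwarz). -/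
theorem p1Quad3_radWeight_le {c : ℝ} (hc : 0 ≤ c) (S1 S2 : ℝ) (x u : Fin 3 → ℝ) :
    p1Quad3 (fun k l => c * fpChi S1 S2 x ^ 2 * (fpSq x)⁻¹ ^ 5 * (x k * x l)) u ≤
      (c * fpChi S1 S2 x ^ 2 * (fpSq x)⁻¹ ^ 4) * (u 0 ^ 2 + u 1 ^ 2 + u 2 ^ 2) := by
  rw [p1Quad3_radWeight]
  have hχ : 0 ≤ c * fpChi S1 S2 x ^ 2 := by positivity
  have hkey : (fpSq x)⁻¹ ^ 5 * fpDot x u ^ 2 ≤ (fpSq x)⁻¹ ^ 4 * (u 0 ^ 2 + u 1 ^ 2 + u 2 ^ 2) := by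
    by_cases hs : fpSq x = 0
    · have hl : (fpSq x)⁻¹ ^ 5 * fpDot x u ^ 2 = 0 := by rw [hs]; simp
      rw [hl]
      positivity
    · have hs0 : 0 < fpSq x := lt_of_le_of_ne (fpSq_nonneg x) (Ne.symm hs)
      have h1 : fpDot x u ^ 2 ≤ fpSq x * fpSq u := fpDot_sq_le x u
      have h2 : (fpSq x)⁻¹ * fpDot x u ^ 2 ≤ fpSq u := by
        rw [inv_mul_le_iff₀ hs0]; exact h1
      calc (fpSq x)⁻¹ ^ 5 * fpDot x u ^ 2 = (fpSq x)⁻¹ ^ 4 * ((fpSq x)⁻¹ * fpDot x u ^ 2) := by ring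
        _ ≤ (fpSq x)⁻¹ ^ 4 * fpSq u := mul_le_mul_of_nonneg_left h2 (by positivity)
        _ = (fpSq x)⁻¹ ^ 4 * (u 0 ^ 2 + u 1 ^ 2 + u 2 ^ 2) := rfl
  calc c * fpChi S1 S2 x ^ 2 * (fpSq x)⁻¹ ^ 5 * fpDot x u ^ 2 = (c * fpChi S1 S2 x ^ 2) * ((fpSq x)⁻¹ ^ 5 * fpDot x u ^ 2) := by ring
    _ ≤ (c * fpChi S1 S2 x ^ 2) * ((fpSq x)⁻¹ ^ 4 * (u 0 ^ 2 + u 1 ^ 2 + u 2 ^ 2)) := mul_le_mul_of_nonneg_left hkey hχ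
    _ = (c * fpChi S1 S2 x ^ 2 * (fpSq x)⁻¹ ^ 4) * (u 0 ^ 2 + u 1 ^ 2 + u 2 ^ 2) := by ring

/-- The credit form equals the majorant times `|u|²` (so it is dominated by it). -/
theorem p1Quad3_credWeight_le (c S1 S2 : ℝ) (x u : Fin 3 → ℝ) :
    p1Quad3 (fun k l => c * fpChi S1 S2 x ^ 2 * (fpSq x)⁻¹ ^ 4 * (if k = l then 1 else 0)) u ≤
      (c * fpChi S1 S2 x ^ 2 * (fpSq x)⁻¹ ^ 4) * (u 0 ^ 2 + u 1 ^ 2 + u 2 ^ 2) :=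
  (p1Quad3_credWeight c S1 S2 x u).le

/-! ## Integrability of the majorant against linear growth -/

/-- `χ² = O(1)` at infinity (`|χ| ≤ 1`). -/
theorem isBigO_fpChi_sq_gauge (S1 S2 : ℝ) :
    (fun y : Fin 3 → ℝ => fpChi S1 S2 y ^ 2) =O[cocompact (Fin 3 → ℝ)] fun y => ‖y‖ ^ (0 : ℤ) := by
  refine IsBigO.of_bound 1 (Eventually.of_forall fun y => ?_)
  have h1 := abs_fpChi_le_one S1 S2 y
  rw [zpow_zero, norm_one, mul_one, Real.norm_eq_abs, abs_pow, sq_le_one_iff_abs_le_one, abs_abs]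
  exact h1

/-- `1 + ‖y‖ = O(‖y‖)` at infinity. -/
theorem isBigO_one_add_norm_gauge :
    (fun y : Fin 3 → ℝ => 1 + ‖y‖) =O[cocompact (Fin 3 → ℝ)] fun y => ‖y‖ ^ (1 : ℤ) := by
  refine IsBigO.of_bound 2 ?_
  filter_upwards [eventually_cocompact_norm_ge 1] with y hy
  rw [zpow_one, norm_norm, Real.norm_of_nonneg (by positivity)]
  linarith

/-- **The majorant against linear growth is integrable**: `y ↦ (c·χ(y)²·|y|⁻⁸)·(1+‖y‖)²` is integrable on `ℝ³` (continuous, `O(‖y‖⁻⁶)`). -/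
theorem integrable_bareMajorant_growth {S1 S2 : ℝ} (hS1 : 0 < S1) (hS12 : S1 < S2) (c : ℝ) :
    Integrable fun y : Fin 3 → ℝ => (c * fpChi S1 S2 y ^ 2 * (fpSq y)⁻¹ ^ 4) * (1 + ‖y‖) ^ 2 := by
  have hcont : Continuous fun y : Fin 3 → ℝ => (c * fpChi S1 S2 y ^ 2 * (fpSq y)⁻¹ ^ 4) * (1 + ‖y‖) ^ 2 := by
    have h := continuous_fpChi_sq_mul hS1 hS12 (g := fun y => c * (fpSq y)⁻¹ ^ 4 * (1 + ‖y‖) ^ 2) fun x hx =>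
      (continuousAt_const.mul (continuousAt_fpSq_inv_pow hx 4)).mul
        ((continuousAt_const.add continuous_norm.continuousAt).pow 2)
    exact h.congr fun x => by ring
  have hO : (fun y : Fin 3 → ℝ => (c * fpChi S1 S2 y ^ 2 * (fpSq y)⁻¹ ^ 4) * (1 + ‖y‖) ^ 2) =O[cocompact (Fin 3 → ℝ)]
      fun y => ‖y‖ ^ ((0 : ℤ) + 0 + -2 * ((4 : ℕ) : ℤ) + 1 * ((2 : ℕ) : ℤ)) :=
    isBigO_gauge_mul' (isBigO_gauge_mul' (isBigO_gauge_mul' (isBigO_const_gauge c) (isBigO_fpChi_sq_gauge S1 S2))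
      (isBigO_fpSq_inv_pow_gauge 4)) (isBigO_gauge_pow isBigO_one_add_norm_gauge 2)
  exact integrable_of_isBigO_gauge hcont (k := (0 : ℤ) + 0 + -2 * ((4 : ℕ) : ℤ) + 1 * ((2 : ℕ) : ℤ)) (by norm_num) hO

/-- The majorant itself is integrable. -/
theorem integrable_bareMajorant {S1 S2 : ℝ} (hS1 : 0 < S1) (hS12 : S1 < S2) (c : ℝ) (hc : 0 ≤ c) :
    Integrable fun y : Fin 3 → ℝ => c * fpChi S1 S2 y ^ 2 * (fpSq y)⁻¹ ^ 4 := by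
  refine (integrable_bareMajorant_growth hS1 hS12 c).mono' (continuous_bareMajorant hS1 hS12 c).aestronglyMeasurable
    (Eventually.of_forall fun y => ?_)
  have h0 : 0 ≤ c * fpChi S1 S2 y ^ 2 * (fpSq y)⁻¹ ^ 4 := by have := fpSq_nonneg y; positivity
  rw [Real.norm_eq_abs, abs_of_nonneg h0]
  have h1 : (1 : ℝ) ≤ (1 + ‖y‖) ^ 2 := by nlinarith [norm_nonneg y]
  nlinarith

/-! ## The lattice far-credit family is summable for the far-ledger field -/

/-- **Summability of the per-cell bare family** `T ↦ Σ_m p1CellBare_T,m` for the far-ledger field, for any continuous weight with `0 ≤ q_W(u) ≤ ω|u|²` and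
`ω(1+‖y‖)²` integrable (the `hsum` of the Jensen/credit transfer `integral_quad_p1Field_le_tsum_p1SiteBare`).  NOT a proof of H12⋆, NOT summit progress. -/
theorem summable_cellBare_p1DispSite {a h : ℝ} (ha : 0 < a) (hh : 0 < h) (W : (Fin 3 → ℝ) → Fin 3 → Fin 3 → ℝ)
    (hWc : ∀ k l, Continuous fun x => W x k l) (hW0 : ∀ y : Fin 3 → ℝ, ∀ u : Fin 3 → ℝ, 0 ≤ p1Quad3 (W y) u)
    {ω : (Fin 3 → ℝ) → ℝ}
    (hω : ∀ y : Fin 3 → ℝ, ∀ u : Fin 3 → ℝ, p1Quad3 (W y) u ≤ ω y * (u 0 ^ 2 + u 1 ^ 2 + u 2 ^ 2))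
    (hωi : Integrable fun y => ω y * (1 + ‖y‖) ^ 2)
    (U : ℤ × ℤ × ℤ → (Fin 3 → ℝ)) (hU : (support U).Finite) (b₀ : Fin 3 → ℝ) (A : Fin 3 → Fin 3 → ℝ) :
    Summable fun i => ∑ m, p1CellBare a h W (fun n k => p1DispSite a h U b₀ A n k) i m := by
  have ha' := ha.ne'
  have hh' := hh.ne'
  obtain ⟨M, hM0, hM⟩ := exists_linearGrowth_p1Disp ha hh U hU b₀ A
  set d : ℝ := 2 * (2 * |a| + |h|) with hd
  have hd0 : 0 ≤ d := by positivity
  set K : ℝ := 3 * (M * (1 + d)) ^ 2 with hK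
  have hω0 : ∀ y, 0 ≤ ω y := fun y => p1Quad3_majorant_nonneg (hW0 y) (hω y)
  -- the value at a vertex is controlled by (1 + ‖y‖) for y in the cell
  have hvert : ∀ (i : (ℤ × ℤ × ℤ) × Fin 6) (m : Fin 4), ∀ y ∈ p1RealCell a h i, ∀ k : Fin 3,
      (p1DispSite a h U b₀ A (i.1 + p1VertOff (p1Par i.1) i.2 m) k) ^ 2 ≤ (M * (1 + d)) ^ 2 * (1 + ‖y‖) ^ 2 := by
    intro i m y hy k
    set v : Fin 3 → ℝ := fun j => hcpSite a h (i.1 + p1VertOff (p1Par i.1) i.2 m) j with hv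
    have hnv : ‖v‖ ≤ ‖y‖ + d := by
      refine (pi_norm_le_iff_of_nonneg (by positivity)).2 fun j => ?_
      have h1 := abs_sub_vertex_le_of_mem_p1RealCell ha' hh' hy m j
      have h2 : |y j| ≤ ‖y‖ := by rw [← Real.norm_eq_abs]; exact norm_le_pi_norm y j
      rw [Real.norm_eq_abs]
      rw [abs_le] at h1 h2 ⊢
      constructor <;> linarith [h1.1, h1.2, h2.1, h2.2]
    have h3 : |p1Disp a h U b₀ A v k| ≤ M * (1 + ‖v‖) := hM v k
    have h4 : |p1Disp a h U b₀ A v k| ≤ M * (1 + d) * (1 + ‖y‖) := by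
      refine h3.trans ?_
      have : M * (1 + ‖v‖) ≤ M * (1 + (‖y‖ + d)) := mul_le_mul_of_nonneg_left (by linarith) hM0
      refine this.trans ?_
      nlinarith [mul_nonneg (mul_nonneg hM0 hd0) (norm_nonneg y)]
    have h5 : p1DispSite a h U b₀ A (i.1 + p1VertOff (p1Par i.1) i.2 m) k = p1Disp a h U b₀ A v k := by
      simp only [p1DispSite, PiLp.toLp_apply, hv]
    rw [h5]
    have h6 : 0 ≤ M * (1 + d) * (1 + ‖y‖) := by positivity
    calc (p1Disp a h U b₀ A v k) ^ 2 ≤ (M * (1 + d) * (1 + ‖y‖)) ^ 2 := sq_le_sq' (abs_le.1 h4).1 (abs_le.1 h4).2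
      _ = (M * (1 + d)) ^ 2 * (1 + ‖y‖) ^ 2 := by ring
  -- per-cell, per-vertex bound of the bare term by K·∫_T ω(1+‖y‖)²
  have hcell : ∀ (i : (ℤ × ℤ × ℤ) × Fin 6) (m : Fin 4),
      p1CellBare a h W (fun n k => p1DispSite a h U b₀ A n k) i m ≤ K * ∫ y in p1RealCell a h i, ω y * (1 + ‖y‖) ^ 2 := by
    intro i m
    have hKc := isCompact_p1RealCell ha' hh' i
    unfold p1CellBare
    rw [← integral_const_mul]
    refine setIntegral_mono_on ?_ ?_ (isClosed_p1RealCell a h i).measurableSet fun y hy => ?_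
    · refine ContinuousOn.integrableOn_compact hKc (Continuous.continuousOn ?_)
      refine (continuous_p1Lam a h i m).mul ?_
      unfold p1Quad3
      exact continuous_finsetSum _ fun k _ => continuous_finsetSum _ fun l _ => ((hWc k l).mul continuous_const).mul continuous_const
    · exact (hωi.const_mul K).integrableOn
    · have hl0 : 0 ≤ p1Lam a h i m y := p1Lam_nonneg_of_mem hy m
      have hl1 : p1Lam a h i m y ≤ 1 := by
        have hle := Finset.single_le_sum (f := fun m' => p1Lam a h i m' y) (fun m' _ => p1Lam_nonneg_of_mem hy m') (Finset.mem_univ m)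
        simpa only [sum_p1Lam_eq_one] using hle
      have hq := hω y (p1CellVals (fun n k => p1DispSite a h U b₀ A n k) i m)
      have hq0 := hW0 y (p1CellVals (fun n k => p1DispSite a h U b₀ A n k) i m)
      simp only [p1CellVals] at hq hq0 ⊢
      have hsq := fun k => hvert i m y hy k
      have hsum3 : (p1DispSite a h U b₀ A (i.1 + p1VertOff (p1Par i.1) i.2 m) 0) ^ 2 +
          (p1DispSite a h U b₀ A (i.1 + p1VertOff (p1Par i.1) i.2 m) 1) ^ 2 +
          (p1DispSite a h U b₀ A (i.1 + p1VertOff (p1Par i.1) i.2 m) 2) ^ 2 ≤ 3 * ((M * (1 + d)) ^ 2 * (1 + ‖y‖) ^ 2) := by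
        linarith [hsq 0, hsq 1, hsq 2]
      calc p1Lam a h i m y * p1Quad3 (W y) (fun k => p1DispSite a h U b₀ A (i.1 + p1VertOff (p1Par i.1) i.2 m) k)
          ≤ 1 * (ω y * (3 * ((M * (1 + d)) ^ 2 * (1 + ‖y‖) ^ 2))) :=
            mul_le_mul hl1 (hq.trans (mul_le_mul_of_nonneg_left hsum3 (hω0 y))) hq0 zero_le_one
        _ = K * (ω y * (1 + ‖y‖) ^ 2) := by rw [hK]; ring
  -- sum over the four vertices and over the cells
  have hI0 : ∀ i, 0 ≤ ∫ y in p1RealCell a h i, ω y * (1 + ‖y‖) ^ 2 := fun i =>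
    setIntegral_nonneg (isClosed_p1RealCell a h i).measurableSet fun y _ => mul_nonneg (hω0 y) (by positivity)
  have hcells : Summable fun i => ∫ y in p1RealCell a h i, ω y * (1 + ‖y‖) ^ 2 := (hasSum_setIntegral_p1RealCell ha' hh' hωi).summable
  refine Summable.of_nonneg_of_le (fun i => Finset.sum_nonneg fun m _ => p1CellBare_nonneg _ i (fun y _ u => hW0 y u) m)
    (fun i => ?_) (hcells.mul_left (4 * K))
  calc ∑ m, p1CellBare a h W (fun n k => p1DispSite a h U b₀ A n k) i m
      ≤ ∑ _m : Fin 4, K * ∫ y in p1RealCell a h i, ω y * (1 + ‖y‖) ^ 2 := Finset.sum_le_sum fun m _ => hcell i m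
    _ = 4 * K * ∫ y in p1RealCell a h i, ω y * (1 + ‖y‖) ^ 2 := by simp; ring

/-! ## The two bare-demand transfers, instantiated for the ledger's weights -/

/-- **RADIAL DEFICIT, far-ledger field, ledger weight**: for `c ≥ 0`, `0 < S₁ < S₂`, bounded radii `|ρ_T| ≤ ρ₀` with the vertex-distance property, and `U` finitely supported,
`Σ'_q p1SiteBare[cχ²s⁻⁵xxᵀ](V)_q ≤ ∫ cχ²s⁻⁵⟪x, p1Disp x⟫² dx + Σ'_T (∫_T cχ²s⁻⁴)·ρ_T·|G_T(U) − A|²_F`.  NOT a proof of H12⋆, NOT summit progress. -/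
theorem tsum_p1SiteBare_rad_le_p1DispSite {a h c S1 S2 : ℝ} (ha : 0 < a) (hh : 0 < h) (hc : 0 ≤ c) (hS1 : 0 < S1) (hS12 : S1 < S2)
    (U : ℤ × ℤ × ℤ → (Fin 3 → ℝ)) (hU : (support U).Finite) (b₀ : Fin 3 → ℝ) (A : Fin 3 → Fin 3 → ℝ)
    (cT : (ℤ × ℤ × ℤ) × Fin 6 → Fin 3 → ℝ) (ρ : (ℤ × ℤ × ℤ) × Fin 6 → ℝ)
    (hρ : ∀ i, ∀ m : Fin 4, fpSq (fun k => hcpSite a h (i.1 + p1VertOff (p1Par i.1) i.2 m) k - cT i k) ≤ ρ i)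
    {ρ₀ : ℝ} (hρ₀ : ∀ i, |ρ i| ≤ ρ₀) :
    Summable (p1SiteBare a h (fun x k l => c * fpChi S1 S2 x ^ 2 * (fpSq x)⁻¹ ^ 5 * (x k * x l)) (fun n k => p1DispSite a h U b₀ A n k)) ∧
    ∑' q, p1SiteBare a h (fun x k l => c * fpChi S1 S2 x ^ 2 * (fpSq x)⁻¹ ^ 5 * (x k * x l)) (fun n k => p1DispSite a h U b₀ A n k) q ≤
      (∫ x, c * fpChi S1 S2 x ^ 2 * (fpSq x)⁻¹ ^ 5 * fpDot x (p1Disp a h U b₀ A x) ^ 2) +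
        ∑' i, (∫ y in p1RealCell a h i, c * fpChi S1 S2 y ^ 2 * (fpSq y)⁻¹ ^ 4) * (ρ i * fpFrob (fun j k => p1CellGrad a h U i j k - A j k)) := by
  have h := tsum_p1SiteBare_le_rad_p1DispSite ha hh (fun x k l => c * fpChi S1 S2 x ^ 2 * (fpSq x)⁻¹ ^ 5 * (x k * x l))
    (continuous_radWeight hS1 hS12 c) (p1Quad3_radWeight_nonneg hc S1 S2) (continuous_bareMajorant hS1 hS12 c)
    (p1Quad3_radWeight_le hc S1 S2) (integrable_bareMajorant_growth hS1 hS12 c) U hU b₀ A cT ρ hρ hρ₀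
  simp only [p1Quad3_radWeight] at h
  exact h

/-- **CREDIT, far-ledger field, ledger weight** (Jensen direction): for `c ≥ 0`, `0 < S₁ < S₂` and `U` finitely supported,
`∫ cχ²s⁻⁴|p1Disp|² ≤ Σ'_q p1SiteBare[cχ²s⁻⁴I](V)_q` (summable).  NOT a proof of H12⋆, NOT summit progress. -/
theorem integral_cred_le_tsum_p1SiteBare_p1DispSite {a h c S1 S2 : ℝ} (ha : 0 < a) (hh : 0 < h) (hc : 0 ≤ c) (hS1 : 0 < S1) (hS12 : S1 < S2)
    (U : ℤ × ℤ × ℤ → (Fin 3 → ℝ)) (hU : (support U).Finite) (b₀ : Fin 3 → ℝ) (A : Fin 3 → Fin 3 → ℝ) :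
    Summable (p1SiteBare a h (fun x k l => c * fpChi S1 S2 x ^ 2 * (fpSq x)⁻¹ ^ 4 * (if k = l then 1 else 0))
      (fun n k => p1DispSite a h U b₀ A n k)) ∧
    (∫ x, c * fpChi S1 S2 x ^ 2 * (fpSq x)⁻¹ ^ 4 * (p1Disp a h U b₀ A x 0 ^ 2 + p1Disp a h U b₀ A x 1 ^ 2 + p1Disp a h U b₀ A x 2 ^ 2)) ≤
      ∑' q, p1SiteBare a h (fun x k l => c * fpChi S1 S2 x ^ 2 * (fpSq x)⁻¹ ^ 4 * (if k = l then 1 else 0))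
        (fun n k => p1DispSite a h U b₀ A n k) q := by
  have hint := integrable_p1Quad3_p1Field_p1DispSite ha hh (fun x k l => c * fpChi S1 S2 x ^ 2 * (fpSq x)⁻¹ ^ 4 * (if k = l then 1 else 0))
    (continuous_credWeight hS1 hS12 c) (p1Quad3_credWeight_nonneg hc S1 S2) (p1Quad3_credWeight_le c S1 S2)
    (integrable_bareMajorant_growth hS1 hS12 c) U hU b₀ A
  have hsum := summable_cellBare_p1DispSite ha hh (fun x k l => c * fpChi S1 S2 x ^ 2 * (fpSq x)⁻¹ ^ 4 * (if k = l then 1 else 0))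
    (continuous_credWeight hS1 hS12 c) (p1Quad3_credWeight_nonneg hc S1 S2)
    (p1Quad3_credWeight_le c S1 S2) (integrable_bareMajorant_growth hS1 hS12 c) U hU b₀ A
  have h := integral_quad_p1Field_le_tsum_p1SiteBare ha hh (fun x k l => c * fpChi S1 S2 x ^ 2 * (fpSq x)⁻¹ ^ 4 * (if k = l then 1 else 0))
    (continuous_credWeight hS1 hS12 c) (p1Quad3_credWeight_nonneg hc S1 S2) _ hint hsum
  rw [← p1Disp_eq_p1Field ha.ne' hh.ne' U b₀ A] at h
  simp only [p1Quad3_credWeight] at h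
  exact h

end Summit.AtomisticToContinuum.Crystallization.Theorems.StrictSplittingRuleBirth

end
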